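import Summits.CriticalPhenomena.PercolationContinuityZ3.Theorems.PercNearOneGluingNoHeavyLowerTailSahiCTCRtThreeDealReduction
import HarnessLib

/-!
# `NoHeavyLowerTail` (crux stmt-CriticalPhenomena-4575), P3 lane: the DEAL REDUCTION at a GENERAL profile (rows 0, 1, 2 of the open core) —
# sub-cube Kleitman matchings of `𝒵` and one dealing certificate for `(𝒵, m)` prove `[s^m] R_3(𝒳,𝒵) ≥ 0` for every up-set `𝒳`

Support file (seat `prim-l12-p3`, gen 47; `--supports stmt-CriticalPhenomena-4575`).  Memo
`run/shared/lean/prim/prim-l12/FROM-prim-l12-p3-g47-TRANSPORT-CERTIFICATES.md` §4 (general profiles).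

This is `…SahiCTCRtThreeDealReduction` (the squarefree row) verbatim on SUB-CUBES.  For a profile `m ≤ 2` (pointwise) the deal form
`R_3 = Θ₂·H(X₃,𝒵) − X_{<3}·(Θ₂·Z₃ − e_{≥3}·Z_{<3})` (`Rt_three_eq_dealPoly`) gives
* `coeff_Rt_three_eq_kap_sub_debt` : **`[s^m] R_3 = Σ_{T small, 1_T ≤ m} κ(X₃,𝒵)(dbl(m−1_T), sgl(m−1_T)) − Σ_{P ∈ X_{<3}, 1_P ≤ m} debt_m(𝒵,P)`**,
  `debt_m(𝒵,P) := [s^{m−1_P}](Θ₂·Z₃ − e_{≥3}·Z_{<3})` (a quantity of `𝒵` alone; memo: `t^m_𝒵(P) − e^m_𝒵(P)`);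
* sub-cube classes `DclC 𝒵 D s = {N ⊆ s : D∪N ∉ 𝒵, D∪(s∖N) ∈ 𝒵}`, `CclC` (complements), `kap_eq_card_CclC_sub_card_DclC` :
  `κ(A,𝒵)(D,s) = #{N ∈ CclC : D∪N ∈ A} − #{N ∈ DclC : D∪N ∈ A}`;
* `exists_increasing_injection_DclC` : Kleitman's lemma on the sub-cube as an increasing injection `DclC → CclC` (Hall + `kap_nonneg`);
* `card_credits_le_kap_cube` (**(II)**) : `#{N ∈ DclC : #(D∪N) ≤ 2, D ∪ M N ∈ X₃} ≤ κ(X₃,𝒵)(D,s)` for any such injection `M`;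
* **`coeff_Rt_three_nonneg_of_deal_profile`** (**(III)**) : given such injections `M T` on the sub-cubes `(dbl(m−1_T), sgl(m−1_T))` (`T` small,
  `1_T ≤ m`) and a dealing `pay` of the credits `(T,N)` [`N ∈ DclC`, `#(D_T ∪ N) ≤ 2`, `3 ≤ #(D_T ∪ M T N)`] to sets `pay(T,N) ⊆ D_T ∪ M T N`
  such that every small member `P` of `𝒳` with `1_P ≤ m` receives at least `debt_m(𝒵,P)` credits, `0 ≤ [s^m] R_3(𝒳,𝒵)`.
With the tree's reduction `coeff_Rt_three_nonneg_of_loopFree'` (p590358: `R_3 ∈ ℕ[s]` ⟸ the rows `m ≤ 2`, `#dbl m ≤ 2`, loop-free singles),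
the memo's conjecture (DEAL) — existence of these certificates for every `𝒵` and every such `m` — would close `R_3 ∈ ℕ[s]`.  Nothing is
asserted about the crux; (DEAL) is verified numerically (rows 0–2, k ≤ 8) and not proved.
-/

noncomputable section

open scoped Classical

namespace Summit.CriticalPhenomena.PercolationContinuityZ3.Theorems.SahiCTCForms

open Finset MvPolynomial SahiCTCGenFun

variable {α : Type*} [DecidableEq α] [Fintype α]

/-! ### The deal form at a general profile -/

/-- The `𝒵`-debt of a small set `P` at profile `m`: `[s^{m − 1_P}](Θ₂·Z₃ − e_{≥3}·Z_{<3})` — the number of ways to complete `P` by a small idle set and a big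
member of `𝒵` to the profile `m`, minus the ways to complete it by a big idle set and a small member of `𝒵` (memo: `t^m_𝒵(P) − e^m_𝒵(P)`). [this work] -/
def debtAt (m : α →₀ ℕ) (G : Finset (Finset α)) (P : Finset α) : ℤ :=
  (gf (bySize (· < 3)) * gf (atLeast 3 G) - gf (bySize (3 ≤ ·)) * gf (below 3 G)).coeff (m - ind P)

omit [DecidableEq α] [Fintype α] in
/-- A residual profile `m − 1_w` of a profile `m ≤ 2` is `≤ 2`. [this work] -/
theorem sub_ind_apply_le_two {m : α →₀ ℕ} (hm : ∀ i, m i ≤ 2) (w : Finset α) (i : α) : (m - ind w) i ≤ 2 := by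
  rw [Finsupp.tsub_apply]; exact (Nat.sub_le _ _).trans (hm i)

/-- **THE DEAL FORM AT PROFILE `m`**: for `m ≤ 2` pointwise,
`[s^m] R_3(𝒳,𝒵) = Σ_{T : #T ≤ 2, 1_T ≤ m} κ(X₃,𝒵)(dbl(m − 1_T), sgl(m − 1_T)) − Σ_{P ∈ X_{<3}, 1_P ≤ m} debt_m(𝒵,P)` — Kleitman surpluses of the big part
of `𝒳` against `𝒵` on the sub-cubes of the profile, minus one `𝒵`-debt per small member of `𝒳` (memo §4, general-profile identity). [this work] -/
theorem coeff_Rt_three_eq_kap_sub_debt (F G : Finset (Finset α)) {m : α →₀ ℕ} (hm : ∀ i, m i ≤ 2) :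
    (Rt 3 F G).coeff m =
      (∑ T ∈ (bySize (· < 3) : Finset (Finset α)).filter (fun T => ind T ≤ m),
          kap (atLeast 3 F) G (dbl (m - ind T)) (sgl (m - ind T)))
      - ∑ P ∈ (below 3 F).filter (fun P => ind P ≤ m), debtAt m G P := by
  have hpoly : Rt 3 F G = gf (bySize (· < 3)) * (PiP * gf (atLeast 3 F ∩ G) - gf (atLeast 3 F) * gf G)
      - gf (below 3 F) * (gf (bySize (· < 3)) * gf (atLeast 3 G) - gf (bySize (3 ≤ ·)) * gf (below 3 G)) := by
    rw [Rt_three_eq_dealPoly]; ring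
  rw [hpoly, coeff_sub, coeff_gf_mul, coeff_gf_mul]
  congr 1
  refine sum_congr rfl fun T _ => ?_
  exact coeff_harrisForm_eq_kap _ _ (sub_ind_apply_le_two hm T)

/-! ### Sub-cube classes and Kleitman's lemma as a matching -/

/-- `DclC 𝒵 D s = {N ⊆ s : D ∪ N ∉ 𝒵 ∧ D ∪ (s∖N) ∈ 𝒵}` — the debits of the sub-cube with base `D` and free set `s`. [this work] -/
def DclC (G : Finset (Finset α)) (D s : Finset α) : Finset (Finset α) := s.powerset.filter fun N => D ∪ N ∉ G ∧ D ∪ (s \ N) ∈ G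

/-- `CclC 𝒵 D s = {N ⊆ s : D ∪ N ∈ 𝒵 ∧ D ∪ (s∖N) ∉ 𝒵}` — the credits of the sub-cube. [this work] -/
def CclC (G : Finset (Finset α)) (D s : Finset α) : Finset (Finset α) := s.powerset.filter fun N => D ∪ N ∈ G ∧ D ∪ (s \ N) ∉ G

omit [Fintype α] in
/-- Membership in `DclC`. [this work] -/
theorem mem_DclC {G : Finset (Finset α)} {D s N : Finset α} : N ∈ DclC G D s ↔ N ⊆ s ∧ D ∪ N ∉ G ∧ D ∪ (s \ N) ∈ G := by
  rw [DclC, mem_filter, mem_powerset]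

omit [Fintype α] in
/-- Membership in `CclC`. [this work] -/
theorem mem_CclC {G : Finset (Finset α)} {D s N : Finset α} : N ∈ CclC G D s ↔ N ⊆ s ∧ D ∪ N ∈ G ∧ D ∪ (s \ N) ∉ G := by
  rw [CclC, mem_filter, mem_powerset]

omit [Fintype α] in
/-- **`κ(A,𝒵)(D,s) = #{N ∈ CclC 𝒵 D s : D∪N ∈ A} − #{N ∈ DclC 𝒵 D s : D∪N ∈ A}`** for every family `A`. [this work] -/
theorem kap_eq_card_CclC_sub_card_DclC (A G : Finset (Finset α)) (D s : Finset α) :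
    kap A G D s = (#((CclC G D s).filter fun N => D ∪ N ∈ A) : ℤ) - #((DclC G D s).filter fun N => D ∪ N ∈ A) := by
  unfold kap
  set T := tr A D s with hT
  have hmemT : ∀ N, N ∈ T ↔ N ⊆ s ∧ D ∪ N ∈ A := fun N => by rw [hT, mem_tr]
  have hmemG : ∀ N, N ∈ tr G D s ↔ N ⊆ s ∧ D ∪ N ∈ G := fun N => by rw [mem_tr]
  have h1 : #(T ∩ tr G D s) = #(T.filter fun N => D ∪ N ∈ G ∧ D ∪ (s \ N) ∈ G) + #(T.filter fun N => D ∪ N ∈ G ∧ D ∪ (s \ N) ∉ G) := by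
    rw [← card_union_of_disjoint (disjoint_filter.2 fun N _ h1 h2 => h2.2 h1.2)]
    congr 1; ext N
    simp only [mem_inter, mem_union, mem_filter, hmemT, hmemG]
    tauto
  have h2 : #(T.filter fun N => s \ N ∈ tr G D s) =
      #(T.filter fun N => D ∪ N ∈ G ∧ D ∪ (s \ N) ∈ G) + #(T.filter fun N => D ∪ N ∉ G ∧ D ∪ (s \ N) ∈ G) := by
    rw [← card_union_of_disjoint (disjoint_filter.2 fun N _ h1 h2 => h2.1 h1.1)]
    congr 1; ext N
    simp only [mem_filter, mem_union, hmemT, hmemG, sdiff_subset, true_and]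
    tauto
  have h3 : (T.filter fun N => D ∪ N ∈ G ∧ D ∪ (s \ N) ∉ G) = (CclC G D s).filter fun N => D ∪ N ∈ A := by
    ext N; simp only [mem_filter, hmemT, mem_CclC]; tauto
  have h4 : (T.filter fun N => D ∪ N ∉ G ∧ D ∪ (s \ N) ∈ G) = (DclC G D s).filter fun N => D ∪ N ∈ A := by
    ext N; simp only [mem_filter, hmemT, mem_DclC]; tauto
  rw [h1, h2, h3, h4]; push_cast; ring

/-- **Kleitman's lemma on a sub-cube as a matching**: for an up-set `𝒵` and disjoint `D, s` there is a map `M`, injective on `DclC 𝒵 D s`, with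
`N ⊆ M N ∈ CclC 𝒵 D s`. [this work] -/
theorem exists_increasing_injection_DclC {G : Finset (Finset α)} (hG : IsUpperSet (G : Set (Finset α))) {D s : Finset α} (hDs : Disjoint D s) :
    ∃ M : Finset α → Finset α, (∀ N ∈ DclC G D s, M N ∈ CclC G D s) ∧ (∀ N ∈ DclC G D s, N ⊆ M N) ∧
      Set.InjOn M (DclC G D s : Set (Finset α)) := by
  set ι := {N : Finset α // N ∈ DclC G D s}
  let t : ι → Finset (Finset α) := fun N => (CclC G D s).filter fun Q => (N : Finset α) ⊆ Q
  have hall : ∀ S : Finset ι, #S ≤ #(S.biUnion t) := by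
    intro S
    let A : Finset (Finset α) := univ.filter fun Q => ∃ N ∈ S, D ∪ (N : Finset α) ⊆ Q
    have hA : IsUpperSet (A : Set (Finset α)) := by
      intro Q Q' hQQ' hQ
      have hQ' : Q ∈ A := hQ
      obtain ⟨N, hN, hNQ⟩ := (mem_filter.1 hQ').2
      exact mem_filter.2 ⟨mem_univ _, N, hN, hNQ.trans hQQ'⟩
    have hk : 0 ≤ kap A G D s := kap_nonneg hA hG s D hDs
    rw [kap_eq_card_CclC_sub_card_DclC] at hk
    have h1 : #S ≤ #((DclC G D s).filter fun N => D ∪ N ∈ A) := by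
      rw [← card_map ⟨Subtype.val, Subtype.val_injective⟩]
      refine card_le_card fun Q hQ => ?_
      obtain ⟨N, hN, rfl⟩ := mem_map.1 hQ
      exact mem_filter.2 ⟨N.2, mem_filter.2 ⟨mem_univ _, N, hN, Subset.rfl⟩⟩
    have h2 : ((CclC G D s).filter fun N => D ∪ N ∈ A) ⊆ S.biUnion t := by
      intro Q hQ
      obtain ⟨hQC, hQA⟩ := mem_filter.1 hQ
      obtain ⟨N, hN, hNQ⟩ := (mem_filter.1 hQA).2
      refine mem_biUnion.2 ⟨N, hN, mem_filter.2 ⟨hQC, ?_⟩⟩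
      -- `N ⊆ s` and `D ∪ N ⊆ D ∪ Q` with `D` disjoint from `s` give `N ⊆ Q`
      intro x hx
      have hxs : x ∈ s := (mem_DclC.1 N.2).1 hx
      have hxD : x ∉ D := fun h => disjoint_left.1 hDs h hxs
      have : x ∈ D ∪ Q := hNQ (mem_union_right _ hx)
      rcases mem_union.1 this with h | h
      · exact absurd h hxD
      · exact h
    have h3 := card_le_card h2
    have h4 : #((DclC G D s).filter fun N => D ∪ N ∈ A) ≤ #((CclC G D s).filter fun N => D ∪ N ∈ A) := by
      have : (#((DclC G D s).filter fun N => D ∪ N ∈ A) : ℤ) ≤ #((CclC G D s).filter fun N => D ∪ N ∈ A) := by linarith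
      exact_mod_cast this
    omega
  obtain ⟨f, hfinj, hft⟩ := (all_card_le_biUnion_card_iff_exists_injective t).1 hall
  refine ⟨fun N => if h : N ∈ DclC G D s then f ⟨N, h⟩ else N, fun N hN => ?_, fun N hN => ?_, fun N hN N' hN' h => ?_⟩
  · simp only [dif_pos hN]; exact (mem_filter.1 (hft ⟨N, hN⟩)).1
  · simp only [dif_pos hN]; exact (mem_filter.1 (hft ⟨N, hN⟩)).2
  · have hN₀ : N ∈ DclC G D s := hN
    have hN₀' : N' ∈ DclC G D s := hN'
    simp only [dif_pos hN₀, dif_pos hN₀'] at h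
    exact congrArg Subtype.val (hfinj h)

omit [Fintype α] in
/-- **(II) on a sub-cube**: for an up-set `𝒳` and any increasing injection `M : DclC 𝒵 D s → CclC 𝒵 D s`, the number of debits `N` with SMALL completed
set `#(D ∪ N) ≤ 2` whose completed image `D ∪ M N` lies in `X₃` is at most `κ(X₃,𝒵)(D,s)`. [this work] -/
theorem card_credits_le_kap_cube {F : Finset (Finset α)} (hF : IsUpperSet (F : Set (Finset α))) (G : Finset (Finset α)) (D s : Finset α)
    (M : Finset α → Finset α) (hMC : ∀ N ∈ DclC G D s, M N ∈ CclC G D s) (hMsub : ∀ N ∈ DclC G D s, N ⊆ M N)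
    (hMinj : Set.InjOn M (DclC G D s : Set (Finset α))) :
    (#((DclC G D s).filter fun N => #(D ∪ N) ≤ 2 ∧ D ∪ M N ∈ atLeast 3 F) : ℤ) ≤ kap (atLeast 3 F) G D s := by
  rw [kap_eq_card_CclC_sub_card_DclC]
  set D₁ := (DclC G D s).filter fun N => D ∪ N ∈ atLeast 3 F
  set D₂ := (DclC G D s).filter fun N => #(D ∪ N) ≤ 2 ∧ D ∪ M N ∈ atLeast 3 F
  have hdisj : Disjoint D₁ D₂ := by
    refine disjoint_filter.2 fun N _ h1 h2 => ?_
    have h3 : 3 ≤ #(D ∪ N) := (mem_filter.1 h1).2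
    have h4 : #(D ∪ N) ≤ 2 := h2.1
    omega
  have himg : (D₁ ∪ D₂).image M ⊆ (CclC G D s).filter fun N => D ∪ N ∈ atLeast 3 F := by
    intro Q hQ
    obtain ⟨N, hN, rfl⟩ := mem_image.1 hQ
    rcases mem_union.1 hN with h | h
    · obtain ⟨hND, hNF⟩ := mem_filter.1 h
      refine mem_filter.2 ⟨hMC N hND, ?_⟩
      simp only [atLeast, mem_filter] at hNF ⊢
      have hsub : D ∪ N ⊆ D ∪ M N := union_subset_union Subset.rfl (hMsub N hND)
      exact ⟨hF hsub hNF.1, hNF.2.trans (card_le_card hsub)⟩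
    · obtain ⟨hND, _, hMN⟩ := mem_filter.1 h
      exact mem_filter.2 ⟨hMC N hND, hMN⟩
  have hinj : Set.InjOn M ((D₁ ∪ D₂ : Finset (Finset α)) : Set (Finset α)) := fun x hx y hy h =>
    hMinj (by rcases mem_union.1 (mem_coe.1 hx) with h' | h' <;> exact (mem_filter.1 h').1)
      (by rcases mem_union.1 (mem_coe.1 hy) with h' | h' <;> exact (mem_filter.1 h').1) h
  have hcard := card_le_card himg
  rw [card_image_of_injOn hinj, card_union_of_disjoint hdisj] at hcard
  have : (#D₁ : ℤ) + #D₂ ≤ #((CclC G D s).filter fun N => D ∪ N ∈ atLeast 3 F) := by exact_mod_cast hcard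
  linarith

/-! ### The deal reduction at profile `m` -/

/-- The CREDITS at profile `m` of a family of maps `M T` on the sub-cubes `(dbl(m−1_T), sgl(m−1_T))` indexed by the small sets `T` with `1_T ≤ m`:
pairs `(T, N)` with `N ∈ DclC`, small completed set `#(dbl(m−1_T) ∪ N) ≤ 2` and big completed image `3 ≤ #(dbl(m−1_T) ∪ M T N)`. [this work] -/
def creditsAt (m : α →₀ ℕ) (G : Finset (Finset α)) (M : Finset α → Finset α → Finset α) : Finset (Finset α × Finset α) :=
  ((bySize (· < 3) : Finset (Finset α)).filter fun T => ind T ≤ m).biUnion fun T =>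
    ((DclC G (dbl (m - ind T)) (sgl (m - ind T))).filter fun N =>
        #(dbl (m - ind T) ∪ N) ≤ 2 ∧ 3 ≤ #(dbl (m - ind T) ∪ M T N)).image fun N => (T, N)

/-- Membership in `creditsAt`. [this work] -/
theorem mem_creditsAt {m : α →₀ ℕ} {G : Finset (Finset α)} {M : Finset α → Finset α → Finset α} {p : Finset α × Finset α} :
    p ∈ creditsAt m G M ↔ #p.1 < 3 ∧ ind p.1 ≤ m ∧ p.2 ∈ DclC G (dbl (m - ind p.1)) (sgl (m - ind p.1)) ∧
      #(dbl (m - ind p.1) ∪ p.2) ≤ 2 ∧ 3 ≤ #(dbl (m - ind p.1) ∪ M p.1 p.2) := by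
  unfold creditsAt
  simp only [mem_biUnion, mem_filter, mem_image, bySize, mem_powerset, subset_univ, true_and]
  constructor
  · rintro ⟨T, ⟨hT3, hTm⟩, N, ⟨hND, hN2, hM3⟩, rfl⟩
    exact ⟨hT3, hTm, hND, hN2, hM3⟩
  · rintro ⟨hT3, hTm, hND, hN2, hM3⟩
    exact ⟨p.1, ⟨hT3, hTm⟩, p.2, ⟨hND, hN2, hM3⟩, rfl⟩

/-- **THE DEAL REDUCTION AT PROFILE `m` (III)**.  Let `𝒳` be an up-set, `𝒵` any family, `m ≤ 2` pointwise.  Given maps `M T` that are increasing injections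
`DclC 𝒵 D_T s_T → CclC 𝒵 D_T s_T` on every sub-cube `D_T = dbl(m − 1_T)`, `s_T = sgl(m − 1_T)` (`T` small, `1_T ≤ m`), and a dealing `pay` with
`pay (T,N) ⊆ D_T ∪ M T N` on credits such that every small member `P` of `𝒳` with `1_P ≤ m` receives at least `debt_m(𝒵,P)` credits, the coefficient
`[s^m] R_3(𝒳,𝒵)` is nonnegative.  For the rows of the open core (singles of `m` loop-free in `𝒳`) the small members of `𝒳` fitting under `m` are edges and
loops/pairs at doubled points; a dealing paying all of them their `𝒵`-debts is a `(𝒵, m)`-only certificate valid for every `𝒳` (memo (DEAL)). [this work] -/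
theorem coeff_Rt_three_nonneg_of_deal_profile {F : Finset (Finset α)} (hF : IsUpperSet (F : Set (Finset α))) (G : Finset (Finset α))
    {m : α →₀ ℕ} (hm : ∀ i, m i ≤ 2) (M : Finset α → Finset α → Finset α)
    (hMC : ∀ T : Finset α, #T < 3 → ind T ≤ m →
      ∀ N ∈ DclC G (dbl (m - ind T)) (sgl (m - ind T)), M T N ∈ CclC G (dbl (m - ind T)) (sgl (m - ind T)))
    (hMsub : ∀ T : Finset α, #T < 3 → ind T ≤ m → ∀ N ∈ DclC G (dbl (m - ind T)) (sgl (m - ind T)), N ⊆ M T N)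
    (hMinj : ∀ T : Finset α, #T < 3 → ind T ≤ m → Set.InjOn (M T) (DclC G (dbl (m - ind T)) (sgl (m - ind T)) : Set (Finset α)))
    (pay : Finset α × Finset α → Finset α) (hpay : ∀ p ∈ creditsAt m G M, pay p ⊆ dbl (m - ind p.1) ∪ M p.1 p.2)
    (hdebt : ∀ P ∈ below 3 F, ind P ≤ m → debtAt m G P ≤ #((creditsAt m G M).filter fun p => pay p = P)) :
    0 ≤ (Rt 3 F G).coeff m := by
  rw [coeff_Rt_three_eq_kap_sub_debt F G hm]
  set Ts := (bySize (· < 3) : Finset (Finset α)).filter fun T => ind T ≤ m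
  set Ps := (below 3 F).filter fun P => ind P ≤ m
  set Cr := creditsAt m G M
  have hTs : ∀ T ∈ Ts, #T < 3 ∧ ind T ≤ m := fun T hT => by
    obtain ⟨h1, h2⟩ := mem_filter.1 hT
    exact ⟨by simpa [bySize] using h1, h2⟩
  -- (1) each sub-cube's surplus dominates its credits with image in X₃
  have h1 : ∀ T ∈ Ts, (#((DclC G (dbl (m - ind T)) (sgl (m - ind T))).filter fun N =>
      #(dbl (m - ind T) ∪ N) ≤ 2 ∧ dbl (m - ind T) ∪ M T N ∈ atLeast 3 F) : ℤ) ≤ kap (atLeast 3 F) G (dbl (m - ind T)) (sgl (m - ind T)) := by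
    intro T hT
    obtain ⟨hT3, hTm⟩ := hTs T hT
    exact card_credits_le_kap_cube hF G _ _ (M T) (hMC T hT3 hTm) (hMsub T hT3 hTm) (hMinj T hT3 hTm)
  -- (2) credits paid into `𝒳` have image in X₃, cube by cube
  have h2 : (#(Cr.filter fun p => pay p ∈ F) : ℤ) ≤ ∑ T ∈ Ts, (#((DclC G (dbl (m - ind T)) (sgl (m - ind T))).filter fun N =>
      #(dbl (m - ind T) ∪ N) ≤ 2 ∧ dbl (m - ind T) ∪ M T N ∈ atLeast 3 F) : ℤ) := by
    have hsub : (Cr.filter fun p => pay p ∈ F) ⊆ Ts.biUnion fun T => ((DclC G (dbl (m - ind T)) (sgl (m - ind T))).filter fun N =>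
        #(dbl (m - ind T) ∪ N) ≤ 2 ∧ dbl (m - ind T) ∪ M T N ∈ atLeast 3 F).image fun N => (T, N) := by
      intro p hp
      obtain ⟨hpC, hpF⟩ := mem_filter.1 hp
      obtain ⟨hT3, hTm, hND, hN2, hM3⟩ := mem_creditsAt.1 hpC
      have hT : p.1 ∈ Ts := mem_filter.2 ⟨by simp [bySize, hT3], hTm⟩
      refine mem_biUnion.2 ⟨p.1, hT, mem_image.2 ⟨p.2, mem_filter.2 ⟨hND, hN2, ?_⟩, ?_⟩⟩
      · simp only [atLeast, mem_filter]
        exact ⟨hF (hpay p hpC) hpF, hM3⟩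
      · rfl
    calc (#(Cr.filter fun p => pay p ∈ F) : ℤ)
        ≤ #(Ts.biUnion fun T => ((DclC G (dbl (m - ind T)) (sgl (m - ind T))).filter fun N =>
            #(dbl (m - ind T) ∪ N) ≤ 2 ∧ dbl (m - ind T) ∪ M T N ∈ atLeast 3 F).image fun N => (T, N)) := by
          exact_mod_cast card_le_card hsub
      _ ≤ ∑ T ∈ Ts, (#(((DclC G (dbl (m - ind T)) (sgl (m - ind T))).filter fun N =>
            #(dbl (m - ind T) ∪ N) ≤ 2 ∧ dbl (m - ind T) ∪ M T N ∈ atLeast 3 F).image fun N => (T, N)) : ℤ) := by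
          exact_mod_cast card_biUnion_le
      _ ≤ _ := by
          refine sum_le_sum fun T _ => ?_
          exact_mod_cast card_image_le
  -- (3) the credits paid to the small members of `𝒳` under `m` are among those paid into `𝒳`
  have h3 : ∑ P ∈ Ps, (#(Cr.filter fun p => pay p = P) : ℤ) ≤ #(Cr.filter fun p => pay p ∈ F) := by
    have : ∑ P ∈ Ps, #(Cr.filter fun p => pay p = P) = #(Cr.filter fun p => pay p ∈ Ps) := by
      rw [card_eq_sum_card_fiberwise (f := pay) (s := Cr.filter fun p => pay p ∈ Ps) (t := Ps) (fun p hp => (mem_filter.1 hp).2)]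
      refine sum_congr rfl fun P hP => ?_
      congr 1; ext p; simp only [mem_filter]
      constructor
      · rintro ⟨h1, h2⟩; exact ⟨⟨h1, h2 ▸ hP⟩, h2⟩
      · rintro ⟨⟨h1, _⟩, h2⟩; exact ⟨h1, h2⟩
    rw [← Nat.cast_sum, this]
    have hsub3 : (Cr.filter fun p => pay p ∈ Ps) ⊆ (Cr.filter fun p => pay p ∈ F) := fun p hp => by
      rw [mem_filter] at hp ⊢
      exact ⟨hp.1, (mem_filter.1 (mem_filter.1 hp.2).1).1⟩
    exact_mod_cast card_le_card hsub3
  -- (4) debts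
  have h4 : ∑ P ∈ Ps, debtAt m G P ≤ ∑ P ∈ Ps, (#(Cr.filter fun p => pay p = P) : ℤ) :=
    sum_le_sum fun P hP => hdebt P (mem_filter.1 hP).1 (mem_filter.1 hP).2
  have h5 : ∑ T ∈ Ts, (#((DclC G (dbl (m - ind T)) (sgl (m - ind T))).filter fun N =>
      #(dbl (m - ind T) ∪ N) ≤ 2 ∧ dbl (m - ind T) ∪ M T N ∈ atLeast 3 F) : ℤ) ≤
      ∑ T ∈ Ts, kap (atLeast 3 F) G (dbl (m - ind T)) (sgl (m - ind T)) := sum_le_sum h1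
  linarith

end Summit.CriticalPhenomena.PercolationContinuityZ3.Theorems.SahiCTCForms
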